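import Literature.AlgebraicGeometry.HodgeTheory.CyclicReflectionEigenprojectors
import HarnessLib

/-!
# Maps commuting with a multiplicity-free `τ ⊗ ℂ` commute with each other
# (the centraliser of a regular semisimple element is abelian) — lane D, hole S2b

Family `hodge`, layer `Literature/AlgebraicGeometry/HodgeTheory`. THEOREMS only, for crux K1 of
`Summits/HodgeConjecture/HodgeConjecture/Theses/CyclicUnitaryPowers.lean` (lane D glue, the low-dimension
branch S2b of the skeleton: if every eigenspace `H(ζ^a)`, `a < p`, of the deck transformation has dimension
`≤ 1`, two `τ`-commuting automorphisms commute, so their commutator is trivial and lies in every identity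
component).  With `V ⊗ ℂ = ⊕_{a<p} H(ζ^a)` (`sum_cyclicEigenProjector`), a map commuting with `τ ⊗ ℂ` preserves
each line `H(ζ^a)` and acts on it by a scalar.
Written by the prover seat `hodge-nonav-prover-Ax`.

## References
* [CarlsonToledo1999] J. A. Carlson, D. Toledo, Duke Math. J. 97 (1999), §2 (p. 5) ("a linear map commutes with
  `σ` if and only if it preserves the eigenspace decomposition").
* [Borel1991] A. Borel, *Linear Algebraic Groups*, IV.12.2 (centralisers of semisimple elements; regular case).
-/

noncomputable section

open Module Literature.AlgebraicGeometry.Motives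
open scoped TensorProduct

namespace Literature.AlgebraicGeometry.HodgeTheory

universe v

variable {V : Type v} [AddCommGroup V] [Module ℚ V]

/-- A map commuting with `τ_ℂ` preserves each eigenspace of `τ_ℂ`. [cite: CarlsonToledo1999, §2 (p. 5)] -/
theorem apply_mem_eigenspace_of_comm {τ : V →ₗ[ℚ] V} {f : ℂ ⊗[ℚ] V →ₗ[ℂ] ℂ ⊗[ℚ] V}
    (hf : f ∘ₗ τ.baseChange ℂ = τ.baseChange ℂ ∘ₗ f) {μ : ℂ} {y : ℂ ⊗[ℚ] V}
    (hy : y ∈ Module.End.eigenspace (τ.baseChange ℂ) μ) : f y ∈ Module.End.eigenspace (τ.baseChange ℂ) μ := by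
  rw [Module.End.mem_eigenspace_iff] at hy ⊢
  have h := congrArg (fun g => g y) hf
  simp only [LinearMap.coe_comp, Function.comp_apply] at h
  rw [← h, hy, map_smul]

/-- On an eigenspace of dimension `≤ 1`, two maps preserving it commute. [cite: Borel1991, IV.12.2] -/
theorem comp_apply_eq_of_finrank_le_one {E : Submodule ℂ (ℂ ⊗[ℚ] V)} [FiniteDimensional ℂ E]
    (hE : finrank ℂ E ≤ 1) {f₁ f₂ : ℂ ⊗[ℚ] V →ₗ[ℂ] ℂ ⊗[ℚ] V} (h₁ : ∀ y ∈ E, f₁ y ∈ E) (h₂ : ∀ y ∈ E, f₂ y ∈ E)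
    {y : ℂ ⊗[ℚ] V} (hy : y ∈ E) : f₁ (f₂ y) = f₂ (f₁ y) := by
  obtain ⟨v₀, hv₀⟩ := finrank_le_one_iff.1 hE
  -- everything in `E` is a multiple of `v₀`
  have hmul : ∀ z ∈ E, ∃ c : ℂ, z = c • (v₀ : ℂ ⊗[ℚ] V) := by
    intro z hz
    obtain ⟨c, hc⟩ := hv₀ ⟨z, hz⟩
    exact ⟨c, by simpa using congrArg Subtype.val hc.symm⟩
  obtain ⟨c, rfl⟩ := hmul y hy
  obtain ⟨b₁, hb₁⟩ := hmul _ (h₁ _ v₀.2)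
  obtain ⟨b₂, hb₂⟩ := hmul _ (h₂ _ v₀.2)
  simp only [map_smul, hb₁, hb₂, smul_smul]
  rw [mul_right_comm]

/-- **Maps commuting with a multiplicity-free `τ ⊗ ℂ` commute.**  If `τ^p`-type eigenspaces `H(ζ^a)`, `a < p`
(`ζ` a primitive `p`-th root of unity) all have dimension `≤ 1`, then any two `ℂ`-linear maps commuting with
`τ ⊗ ℂ` commute with each other (`V ⊗ ℂ = ⊕_a H(ζ^a)` and each acts by scalars on the lines).
[cite: Borel1991, IV.12.2] [cite: CarlsonToledo1999, §2 (p. 5)] -/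
theorem comp_comm_of_finrank_eigenspace_le_one [Module.Finite ℚ V] {τ : V →ₗ[ℚ] V} {p : ℕ} (hτ : τ ^ p = 1)
    {ζ : ℂ} (hζ : IsPrimitiveRoot ζ p) (hp : 0 < p)
    (hdim : ∀ a < p, finrank ℂ (Module.End.eigenspace (τ.baseChange ℂ) (ζ ^ a)) ≤ 1)
    {f₁ f₂ : ℂ ⊗[ℚ] V →ₗ[ℂ] ℂ ⊗[ℚ] V} (h₁ : f₁ ∘ₗ τ.baseChange ℂ = τ.baseChange ℂ ∘ₗ f₁)
    (h₂ : f₂ ∘ₗ τ.baseChange ℂ = τ.baseChange ℂ ∘ₗ f₂) : f₁ ∘ₗ f₂ = f₂ ∘ₗ f₁ := by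
  have hζ0 : ζ ≠ 0 := hζ.ne_zero hp.ne'
  refine LinearMap.ext fun x => ?_
  rw [LinearMap.comp_apply, LinearMap.comp_apply, ← sum_cyclicEigenProjector (τ := τ) hζ hp x, map_sum, map_sum,
    map_sum, map_sum]
  refine Finset.sum_congr rfl fun a ha => ?_
  exact comp_apply_eq_of_finrank_le_one (hdim a (Finset.mem_range.1 ha))
    (fun y hy => apply_mem_eigenspace_of_comm h₁ hy) (fun y hy => apply_mem_eigenspace_of_comm h₂ hy)
    (cyclicEigenProjector_mem_eigenspace hτ hζ.pow_eq_one hζ0 a x)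

end Literature.AlgebraicGeometry.HodgeTheory

end
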